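/-
Copyright (c) 2026. Released under Apache 2.0 license.
-/
import Mathlib.GroupTheory.Commutator.Basic
import Mathlib.GroupTheory.Subgroup.Center
import Mathlib.Algebra.Group.Subgroup.ZPowers.Basic
import Mathlib.Algebra.Group.Commute.Basic
import Mathlib.Algebra.Group.Conj
import Mathlib.Tactic.Group
import HarnessLib

/-!
# Central extensions of dicyclic groups: the centre meets the commutator subgroup trivially

The dicyclic groups `Dic_m = ⟨c, w | c^{2m} = 1, w c w⁻¹ = c⁻¹, w² = c^m⟩` (generalised quaternion groups when
`m` is a power of `2`) have trivial Schur multiplier [Huppert1967, Satz V.25.3]; Calegari–Dimitrov–Tang use this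
for the Sylow `2`-subgroups of `SL₂(𝔽_p)` [CalegariDimitrovTang2025, Lemma 4.5.4].  We prove the elementary
avatar needed for central extensions realised inside a bigger group: let `Z ≤ Z(G)` and `c, w ∈ G` satisfy the
dicyclic relations MODULO `Z` — `w c w⁻¹ c ∈ Z`, `w² c^{-m} ∈ Z`, and `c^{2i} ∈ Z ⇒ m ∣ i` — and put
`L = ⟨c, w, Z⟩`.  With `z₁ = w c w⁻¹ c` and `u = c² z₁⁻¹ = [c, w]`:

* `commutator_closure_le_zpowers` — `[L, L] ≤ ⟨u⟩`;
* `eq_one_of_mem_of_mem_commutator_closure` — **`Z ∩ [L, L] = 1`**.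
-/

namespace Literature.GroupTheory.SpecificGroups

namespace DicyclicCentral

open Subgroup
open scoped commutatorElement

variable {G : Type*} [Group G]

section

variable (Z : Subgroup G) (hZ : Z ≤ center G) (c w : G) (h1 : w * c * w⁻¹ * c ∈ Z)
include hZ h1

omit hZ h1 in
/-- `[c, w] = c² z₁⁻¹` for `z₁ = w c w⁻¹ c` (an identity in any group). [cite: Huppert1967, Satz V.25.3] -/
theorem commutatorElement_eq : ⁅c, w⁆ = c ^ 2 * (w * c * w⁻¹ * c)⁻¹ := by
  set z : G := w * c * w⁻¹ * c with hzdef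
  have hwc : w * c * w⁻¹ = z * c⁻¹ := by rw [hzdef, mul_inv_cancel_right]
  have hwc' : w * c⁻¹ * w⁻¹ = c * z⁻¹ := by
    calc w * c⁻¹ * w⁻¹ = (w * c * w⁻¹)⁻¹ := by group
      _ = (z * c⁻¹)⁻¹ := by rw [hwc]
      _ = c * z⁻¹ := by group
  rw [commutatorElement_def, pow_two]
  calc c * w * c⁻¹ * w⁻¹ = c * (w * c⁻¹ * w⁻¹) := by group
    _ = c * (c * z⁻¹) := by rw [hwc']
    _ = c * c * z⁻¹ := by group

/-- Every element of `L = ⟨c, w, Z⟩` conjugates `u = c² z₁⁻¹` to `u` or to `u⁻¹`.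
[cite: Huppert1967, Satz V.25.3] -/
theorem conj_eq_or_eq_inv {g : G} (hg : g ∈ closure ({c, w} ∪ (Z : Set G))) :
    g * (c ^ 2 * (w * c * w⁻¹ * c)⁻¹) * g⁻¹ = c ^ 2 * (w * c * w⁻¹ * c)⁻¹ ∨
      g * (c ^ 2 * (w * c * w⁻¹ * c)⁻¹) * g⁻¹ = (c ^ 2 * (w * c * w⁻¹ * c)⁻¹)⁻¹ := by
  set z : G := w * c * w⁻¹ * c with hzdef
  set u : G := c ^ 2 * z⁻¹ with hu
  have hz : ∀ g : G, g * z = z * g := mem_center_iff.mp (hZ h1)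
  have hz' : ∀ g : G, g * z⁻¹ = z⁻¹ * g := mem_center_iff.mp (inv_mem (hZ h1))
  have hwc : w * c * w⁻¹ = z * c⁻¹ := by rw [hzdef, mul_inv_cancel_right]
  have hu' : u = c * c * z⁻¹ := by rw [hu, pow_two]
  have Kc : c * u * c⁻¹ = u := by
    rw [hu']
    calc c * (c * c * z⁻¹) * c⁻¹ = c * c * (c * z⁻¹) * c⁻¹ := by group
      _ = c * c * (z⁻¹ * c) * c⁻¹ := by rw [hz' c]
      _ = c * c * z⁻¹ := by group
  have Kw : w * u * w⁻¹ = u⁻¹ := by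
    rw [hu']
    calc w * (c * c * z⁻¹) * w⁻¹ = (w * c * w⁻¹) * (w * c * w⁻¹) * (w * z⁻¹) * w⁻¹ := by group
      _ = (z * c⁻¹) * (z * c⁻¹) * (z⁻¹ * w) * w⁻¹ := by rw [hwc, hz' w]
      _ = z * (c⁻¹ * z) * c⁻¹ * z⁻¹ := by group
      _ = z * (z * c⁻¹) * c⁻¹ * z⁻¹ := by rw [hz c⁻¹]
      _ = z * z * (c⁻¹ * (c⁻¹ * z⁻¹)) := by group
      _ = z * z * (c⁻¹ * (z⁻¹ * c⁻¹)) := by rw [hz' c⁻¹]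
      _ = z * z * ((c⁻¹ * z⁻¹) * c⁻¹) := by group
      _ = z * z * ((z⁻¹ * c⁻¹) * c⁻¹) := by rw [hz' c⁻¹]
      _ = (c * c * z⁻¹)⁻¹ := by group
  refine closure_induction (p := fun g _ ↦ g * u * g⁻¹ = u ∨ g * u * g⁻¹ = u⁻¹) ?_ ?_ ?_ ?_ hg
  · rintro x (hx | hx)
    · rcases hx with rfl | rfl
      · exact Or.inl Kc
      · exact Or.inr Kw
    · left
      rw [← mem_center_iff.mp (hZ hx) u, mul_inv_cancel_right]
  · left; group
  · rintro x y _ _ (hx | hx) (hy | hy)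
    · left
      rw [show x * y * u * (x * y)⁻¹ = x * (y * u * y⁻¹) * x⁻¹ by group, hy, hx]
    · right
      rw [show x * y * u * (x * y)⁻¹ = x * (y * u * y⁻¹) * x⁻¹ by group, hy,
        show x * u⁻¹ * x⁻¹ = (x * u * x⁻¹)⁻¹ by group, hx]
    · right
      rw [show x * y * u * (x * y)⁻¹ = x * (y * u * y⁻¹) * x⁻¹ by group, hy, hx]
    · left
      rw [show x * y * u * (x * y)⁻¹ = x * (y * u * y⁻¹) * x⁻¹ by group, hy,
        show x * u⁻¹ * x⁻¹ = (x * u * x⁻¹)⁻¹ by group, hx, inv_inv]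
  · rintro x _ (hx | hx)
    · left
      calc x⁻¹ * u * x⁻¹⁻¹ = x⁻¹ * (x * u * x⁻¹) * x := by rw [hx]; group
        _ = u := by group
    · right
      calc x⁻¹ * u * x⁻¹⁻¹ = x⁻¹ * (x * u * x⁻¹)⁻¹ * x := by rw [hx, inv_inv]; group
        _ = u⁻¹ := by group

/-- Elements of `L = ⟨c, w, Z⟩` normalise `⟨u⟩`. [cite: Huppert1967, Satz V.25.3] -/
theorem conj_mem_zpowers {g : G} (hg : g ∈ closure ({c, w} ∪ (Z : Set G))) {v : G}
    (hv : v ∈ zpowers (c ^ 2 * (w * c * w⁻¹ * c)⁻¹)) :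
    g * v * g⁻¹ ∈ zpowers (c ^ 2 * (w * c * w⁻¹ * c)⁻¹) := by
  obtain ⟨k, rfl⟩ := mem_zpowers_iff.mp hv
  rw [← conj_zpow]
  rcases conj_eq_or_eq_inv Z hZ c w h1 hg with h | h
  · rw [h]; exact ⟨k, rfl⟩
  · rw [h, inv_zpow']; exact ⟨-k, rfl⟩

/-- **`[L, L] ≤ ⟨u⟩`** for `L = ⟨c, w, Z⟩`, `u = [c, w] = c² z₁⁻¹`. [cite: Huppert1967, Satz V.25.3] -/
theorem commutator_closure_le_zpowers :
    ⁅closure ({c, w} ∪ (Z : Set G)), closure ({c, w} ∪ (Z : Set G))⁆ ≤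
      zpowers (c ^ 2 * (w * c * w⁻¹ * c)⁻¹) := by
  set u : G := c ^ 2 * (w * c * w⁻¹ * c)⁻¹ with hu
  set S : Set G := {c, w} ∪ (Z : Set G) with hS
  have hcw : ⁅c, w⁆ = u := commutatorElement_eq c w
  -- every commutator of two elements of `L` lies in `⟨u⟩`
  have key : ∀ x y : G, x ∈ closure S → y ∈ closure S → ⁅x, y⁆ ∈ zpowers u := by
    intro x y hx hy
    refine closure_induction₂ (p := fun x y _ _ ↦ ⁅x, y⁆ ∈ zpowers u) ?_ ?_ ?_ ?_ ?_ ?_ ?_ hx hy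
    · intro x y hx hy
      -- generators: `c`, `w`, or central
      have hcen : ∀ {a b : G}, a ∈ (Z : Set G) → ⁅a, b⁆ = 1 ∧ ⁅b, a⁆ = 1 := by
        intro a b ha
        have hc := mem_center_iff.mp (hZ ha) b
        constructor
        · rw [commutatorElement_def, ← hc]; group
        · rw [commutatorElement_def, hc]; group
      rcases hx with hx | hx
      · rcases hy with hy | hy
        · rcases hx with rfl | rfl <;> rcases hy with rfl | rfl
          · rw [commutatorElement_self]; exact one_mem _   -- may not exist; fallback below
          · rw [hcw]; exact mem_zpowers u
          · rw [← commutatorElement_inv, hcw]; exact inv_mem (mem_zpowers u)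
          · rw [commutatorElement_self]; exact one_mem _
        · rw [(hcen hy).2]; exact one_mem _
      · rw [(hcen hx).1]; exact one_mem _
    · intro x _; rw [commutatorElement_one_left]; exact one_mem _
    · intro x _; rw [commutatorElement_one_right]; exact one_mem _
    · intro x y v hx _ _ hxv hyv
      rw [show ⁅x * y, v⁆ = x * ⁅y, v⁆ * x⁻¹ * ⁅x, v⁆ by simp only [commutatorElement_def]; group]
      exact mul_mem (conj_mem_zpowers Z hZ c w h1 hx hyv) hxv
    · intro y v x _ _ hx hxy hxv
      rw [show ⁅x, y * v⁆ = ⁅x, y⁆ * (y * ⁅x, v⁆ * y⁻¹) by simp only [commutatorElement_def]; group]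
      refine mul_mem hxy (conj_mem_zpowers Z hZ c w h1 ?_ hxv)
      assumption
    · intro x y hx _ hxy
      rw [show ⁅x⁻¹, y⁆ = x⁻¹ * ⁅x, y⁆⁻¹ * x⁻¹⁻¹ by simp only [commutatorElement_def]; group]
      exact conj_mem_zpowers Z hZ c w h1 (inv_mem hx) (inv_mem hxy)
    · intro x y _ hy hxy
      rw [show ⁅x, y⁻¹⁆ = y⁻¹ * ⁅x, y⁆⁻¹ * y⁻¹⁻¹ by simp only [commutatorElement_def]; group]
      exact conj_mem_zpowers Z hZ c w h1 (inv_mem hy) (inv_mem hxy)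
  rw [Subgroup.commutator_def, closure_le]
  rintro _ ⟨x, hx, y, hy, rfl⟩
  exact key x y hx hy

end

/-- **`Z ∩ [L, L] = 1`** for a central subgroup `Z` and `L = ⟨c, w, Z⟩` with `c, w` satisfying the dicyclic
relations modulo `Z`: `w c w⁻¹ c ∈ Z`, `w² c^{-m} ∈ Z`, and `c^{2i} ∈ Z ⇒ m ∣ i` (the image of `c` has order
`2m` modulo `Z`).  (Dicyclic groups have trivial Schur multiplier.) [cite: Huppert1967, Satz V.25.3] -/
theorem eq_one_of_mem_of_mem_commutator_closure (Z : Subgroup G) (hZ : Z ≤ center G) (c w : G) (m : ℕ)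
    (h1 : w * c * w⁻¹ * c ∈ Z) (h2 : w ^ 2 * (c ^ m)⁻¹ ∈ Z)
    (hord : ∀ i : ℤ, c ^ (2 * i) ∈ Z → (m : ℤ) ∣ i) {z : G} (hzZ : z ∈ Z)
    (hz : z ∈ ⁅closure ({c, w} ∪ (Z : Set G)), closure ({c, w} ∪ (Z : Set G))⁆) : z = 1 := by
  set z₁ : G := w * c * w⁻¹ * c with hz₁def
  set u : G := c ^ 2 * z₁⁻¹ with hu
  have hc1 : ∀ g : G, g * z₁ = z₁ * g := mem_center_iff.mp (hZ h1)
  have hc1' : ∀ g : G, g * z₁⁻¹ = z₁⁻¹ * g := mem_center_iff.mp (inv_mem (hZ h1))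
  have hwc : w * c * w⁻¹ = z₁ * c⁻¹ := by rw [hz₁def, mul_inv_cancel_right]
  -- (1) `c^{2m} = z₁^m`, from conjugating `w² = z₂ c^m` by `w`
  set z₂ : G := w ^ 2 * (c ^ m)⁻¹ with hz₂def
  have hc2 : ∀ g : G, g * z₂ = z₂ * g := mem_center_iff.mp (hZ h2)
  have hw2 : w ^ 2 = z₂ * c ^ m := by rw [hz₂def, inv_mul_cancel_right]
  have hcomm : Commute z₁ c⁻¹ := (hc1 c⁻¹).symm
  have hwcm : w * c ^ m * w⁻¹ = z₁ ^ m * c⁻¹ ^ m := by rw [← conj_pow, hwc, hcomm.mul_pow]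
  have e3 : z₁ ^ m * c⁻¹ ^ m = c ^ m := by
    have e1 : w * w ^ 2 * w⁻¹ = w ^ 2 := by group
    rw [hw2, show w * (z₂ * c ^ m) * w⁻¹ = (w * z₂) * c ^ m * w⁻¹ by group, hc2 w,
      show z₂ * w * c ^ m * w⁻¹ = z₂ * (w * c ^ m * w⁻¹) by group, hwcm] at e1
    exact mul_left_cancel e1
  have hum : u ^ m = 1 := by
    have hcomm2 : Commute (c ^ 2) z₁⁻¹ := hc1' (c ^ 2)
    rw [hu, hcomm2.mul_pow, ← pow_mul, two_mul, pow_add, inv_pow]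
    nth_rewrite 1 [← e3]
    rw [show z₁ ^ m * c⁻¹ ^ m * c ^ m * (z₁ ^ m)⁻¹ = z₁ ^ m * (c⁻¹ ^ m * c ^ m) * (z₁ ^ m)⁻¹ by group,
      inv_pow, inv_mul_cancel, mul_one, mul_inv_cancel]
  -- (2) `z ∈ ⟨u⟩`, say `z = u^i`; then `c^{2i} ∈ Z`, so `m ∣ i` and `z = (u^m)^k = 1`
  have hzW := commutator_closure_le_zpowers Z hZ c w h1 hz
  obtain ⟨i, hi⟩ := mem_zpowers_iff.mp hzW
  have hcomm2 : Commute (c ^ 2) z₁⁻¹ := hc1' (c ^ 2)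
  have hci : c ^ (2 * i) ∈ Z := by
    have h : (c ^ 2 * z₁⁻¹) ^ i = c ^ (2 * i) * z₁⁻¹ ^ i := by
      rw [hcomm2.mul_zpow, zpow_mul, zpow_ofNat]
    have h' : c ^ (2 * i) = z * (z₁⁻¹ ^ i)⁻¹ := by
      rw [← hi, ← hu, h, mul_inv_cancel_right]
    rw [h']
    exact mul_mem hzZ (inv_mem (zpow_mem (inv_mem h1) i))
  obtain ⟨k, hk⟩ := hord i hci
  rw [← hi, ← hu, hk, zpow_mul, zpow_natCast, hum, one_zpow]

end DicyclicCentral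

end Literature.GroupTheory.SpecificGroups
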